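import Mathlib
import Summits.ResolutionOfSingularities.ResolutionOfSingularities.Theorems.WeightedInvariantLocalWeightedDropPersistentOrderPower
import Summits.ResolutionOfSingularities.ResolutionOfSingularities.Theorems.WeightedInvariantLocalWeightedDropWeierstrassForm

/-!
# `LocalWeightedDrop`, NC count game — TOT2-LINE piece S-CRV (C-b), layer K2: PERSISTENT ORDER ⇒ `o`-TH POWER OF A SMOOTH BRANCH
# `y − φ(x)`, and the DISTINGUISHED-POLYNOMIAL COMPARISON (any field)

[OURS · L1 W4.3 · chain w43, engine crux `LocalWeightedDrop` stmt-ResolutionOfSingularities-8899; sub-line under the v32 registered stub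
`stub_spaceNCRankDrop`, design memo `L/res-L1-w43-lead-1/g4/TOT2-LINE.md` v1 §5 (C) (res-L1-w43-lead-1), piece S-CRV = res-type-088
(res-L1-w43-plan-1 DEALS gen 10 #9); `--supports 8899 --as helper`, counted 0; definition-free; nothing here is a statement of any manuscript;
AI-written (gate-accepted = sorry-free with standard axioms, not refereed).]

ROLE IN (C-b) «no infinite chain of near curves».  Along an infinite chain of near-section curve blow-ups over a curve `C` of the
`H^O`-stratum, the surface equation read at the GENERIC POINT of `C` is a plane germ `F ∈ K⟦x, y⟧` over `K = k((t))` whose order `o` persists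
under infinitely many near-point blow-ups; the landed `stub_persistentOrderPower` (every field) gives `F = u · L^o` with `L(0) = 0`,
`∂L/∂y(0) ≠ 0`.  This file supplies the two dictionary-free algebra steps that turn this into coefficient identities usable on the
integral side `k⟦u, t, z⟧`:

* `exists_eq_unit_mul_X_add_pow` — Weierstrass preparation in degree `1` (`WeierstrassForm.exists_weierstrass`, tree): `L = H · (y + a(x))`,
  `a(0) = 0`, so **`F = W · (y + a(x))^o`** with `W(0) ≠ 0`; packaged on top of the persistence theorem as
  **`persistent_order_eq_unit_mul_branch_pow`** (hypotheses VERBATIM those of `stub_persistentOrderPower`).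
* **`distinguished_eq_branch_pow`** — the DISTINGUISHED-POLYNOMIAL COMPARISON: if `v · (y^o + Σ_{j<o} r_j(x) y^j) = W · (y + a(x))^o` with
  `v(0) ≠ 0` and `a(0) = 0`, then `r_j = C(o, j) · a^{o−j}` for every `j < o` (no Weierstrass-uniqueness import: `y`-polynomials with
  `x`-coefficients are `P.eval₂ ι y`, `P ∈ K⟦x⟧[T]` (`coeff_eval₂_rename`); the legal change `y ↦ y + b(x)` acts by `Polynomial.taylor b`
  (`subst_shift_eval₂`); after `y ↦ y − a(x)` the difference `M − (T + a)^o`, of degree `< o`, becomes `y^o`-divisible as a germ, hence zero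
  (`eq_zero_of_eval₂_eq_X_pow_mul`), and `taylor` is invertible).
The integral side (the Weierstrass polynomial of the surface equation is `v · P` with `P` distinguished in `z` over `k⟦u, t⟧`, and the
resulting `r_{o−q} = ∓ m · a^q` forces `a` to be `t`-integral) is the sequel `…NCResCurveGenericDescent`.
-/

set_option linter.dupNamespace false -- mandated namespace of this single-conjunct summit

noncomputable section

namespace Summit.ResolutionOfSingularities.ResolutionOfSingularities.Theorems

namespace TOT2Curve

open MvPowerSeries Literature.AlgebraicGeometry.Resolution

variable {K : Type} [Field K]

/-! ## Degree-one Weierstrass: an order-one germ with `∂/∂y ≠ 0` is a unit times `y + a(x)` -/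

/-- An `L ∈ K⟦x, y⟧` with `L(0) = 0` and `∂L/∂y(0) ≠ 0` is `H · (y + a(x))` with `H(0) ≠ 0`, `a(0) = 0` (`WeierstrassForm.exists_weierstrass`
in degree `1`; `x = X 0`, `y = X 1 = X (Fin.last 1)`, `a` in the `x`-variable alone, embedded by `rename (Fin.succAboveEmb (Fin.last 1))`). -/
theorem exists_eq_unit_mul_X_add (L : MvPowerSeries (Fin 2) K) (hL0 : constantCoeff L = 0) (hL1 : coeff (Finsupp.single 1 1) L ≠ 0) :
    ∃ (H : MvPowerSeries (Fin 2) K) (a : MvPowerSeries (Fin 1) K), constantCoeff H ≠ 0 ∧ constantCoeff a = 0 ∧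
      L = H * (X 1 + rename (Fin.succAboveEmb (Fin.last 1)) a) := by
  have hlow : ∀ n < 1, coeff (Finsupp.single (Fin.last 1) n) L = 0 := by
    intro n hn
    obtain rfl : n = 0 := by omega
    rw [Finsupp.single_zero, coeff_zero_eq_constantCoeff_apply, hL0]
  have htop : coeff (Finsupp.single (Fin.last 1) 1) L ≠ 0 := hL1
  obtain ⟨H, A, hH, hA, hEq⟩ := WeierstrassForm.exists_weierstrass (d := 1) L hlow htop
  refine ⟨H, A 0, hH, hA 0, ?_⟩
  rw [hEq, Fin.sum_univ_one, pow_one, Fin.val_zero, pow_zero, mul_one]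
  rfl

/-- … hence `u · L^o = W · (y + a(x))^o` with `W = u · H^o` a unit. -/
theorem exists_eq_unit_mul_X_add_pow (u L : MvPowerSeries (Fin 2) K) (o : ℕ) (hu : constantCoeff u ≠ 0) (hL0 : constantCoeff L = 0)
    (hL1 : coeff (Finsupp.single 1 1) L ≠ 0) :
    ∃ (W : MvPowerSeries (Fin 2) K) (a : MvPowerSeries (Fin 1) K), constantCoeff W ≠ 0 ∧ constantCoeff a = 0 ∧
      u * L ^ o = W * (X 1 + rename (Fin.succAboveEmb (Fin.last 1)) a) ^ o := by
  obtain ⟨H, a, hH, ha, hEq⟩ := exists_eq_unit_mul_X_add L hL0 hL1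
  refine ⟨u * H ^ o, a, ?_, ha, ?_⟩
  · rw [map_mul, map_pow]
    exact mul_ne_zero hu (pow_ne_zero _ hH)
  · rw [hEq, mul_pow, mul_assoc]

/-- **PERSISTENT ORDER ⇒ `o`-TH POWER OF A SMOOTH BRANCH** (every field; hypotheses VERBATIM those of `stub_persistentOrderPower`): if
`h₀, h₁, … ∈ K⟦x, y⟧` all have order `o ≥ 1`, each `h_{j+1}` the strict transform of `h_j` at the point of slope `T j`
(`h_j(x, x(T_j + y)) = x^o · h_{j+1}`), then `h₀ = W · (y + a(x))^o` with `W(0) ≠ 0` and `a(0) = 0` — the germ is `o` times ONE regular branch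
`y = −a(x)`. [OURS · L1 W4.3] -/
theorem persistent_order_eq_unit_mul_branch_pow (o : ℕ) (ho : 1 ≤ o) (h : ℕ → MvPowerSeries (Fin 2) K) (T : ℕ → K)
    (hord : ∀ j, (h j).order = o) (hstep : ∀ j, subst (PlaneGerm.dirChart (T j)) (h j) = X 0 ^ o * h (j + 1)) :
    ∃ (W : MvPowerSeries (Fin 2) K) (a : MvPowerSeries (Fin 1) K), constantCoeff W ≠ 0 ∧ constantCoeff a = 0 ∧
      h 0 = W * (X 1 + rename (Fin.succAboveEmb (Fin.last 1)) a) ^ o := by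
  obtain ⟨u, L, hu, hL0, hL1, hEq⟩ := stub_persistentOrderPower K o ho h T hord hstep
  obtain ⟨W, a, hW, ha, hWa⟩ := exists_eq_unit_mul_X_add_pow u L o hu hL0 hL1
  exact ⟨W, a, hW, ha, hEq.trans hWa⟩

/-! ## The distinguished-polynomial comparison, in polynomial language

A «`y`-polynomial with `x`-coefficients» is `P.eval₂ ι y` for `P ∈ K⟦x⟧[T]` and `ι = rename` into the `x`-slot. -/

/-- `rename` into the `x`-slot commutes with the shift `y ↦ y + c`, which fixes `x`. -/
theorem subst_shift_rename (c : MvPowerSeries (Fin 2) K) (hc : constantCoeff c = 0) (r : MvPowerSeries (Fin 1) K) :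
    subst (![X 0, X 1 + c] : Fin 2 → MvPowerSeries (Fin 2) K) (rename (Fin.succAboveEmb (Fin.last 1)) r) =
      rename (Fin.succAboveEmb (Fin.last 1)) r := by
  have hs : HasSubst (![X 0, X 1 + c] : Fin 2 → MvPowerSeries (Fin 2) K) :=
    hasSubst_of_constantCoeff_zero fun i => by fin_cases i <;> simp [constantCoeff_X, hc]
  rw [rename_eq_subst, subst_comp_subst_apply (HasSubst.X_comp _) hs]
  congr 1
  funext i
  fin_cases i
  simp [subst_X hs]

/-- COEFFICIENTS: `[x^β y^n] (P.eval₂ ι y) = [x^β] (P.coeff n)`. -/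
theorem coeff_eval₂_rename (P : Polynomial (MvPowerSeries (Fin 1) K)) (β : Fin 1 →₀ ℕ) (n : ℕ) :
    coeff (Finsupp.embDomain (Fin.succAboveEmb (Fin.last 1)) β + Finsupp.single (Fin.last 1) n)
        (P.eval₂ (rename (Fin.succAboveEmb (Fin.last 1))).toRingHom (X (Fin.last 1))) = coeff β (P.coeff n) := by
  classical
  rw [Polynomial.eval₂_eq_sum_range, map_sum]
  have hterm : ∀ i : ℕ, coeff (Finsupp.embDomain (Fin.succAboveEmb (Fin.last 1)) β + Finsupp.single (Fin.last 1) n)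
      ((rename (Fin.succAboveEmb (Fin.last 1))).toRingHom (P.coeff i) * X (Fin.last 1) ^ i) =
        if i = n then coeff β (P.coeff i) else 0 := by
    intro i
    rw [AlgHom.toRingHom_eq_coe, RingHom.coe_coe, TschirnhausForm.coeff_emb_add_single_mul_X_pow]
    by_cases hi : i = n
    · rw [if_pos hi.le, if_pos hi, TschirnhausForm.coeff_emb_add_single_rename, if_pos (by omega)]
    · rw [if_neg hi]
      split_ifs with hle
      · rw [TschirnhausForm.coeff_emb_add_single_rename, if_neg (by omega)]
      · rfl
  simp_rw [hterm]
  by_cases hn : n < P.natDegree + 1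
  · rw [Finset.sum_eq_single n]
    · rw [if_pos rfl]
    · intro i _ hi; exact if_neg hi
    · intro h; exact absurd (Finset.mem_range.mpr hn) h
  · rw [Finset.sum_eq_zero (fun i hi => if_neg (by rw [Finset.mem_range] at hi; omega)),
      Polynomial.coeff_eq_zero_of_natDegree_lt (by omega), map_zero]

/-- A `y`-POLYNOMIAL OF DEGREE `< o` WITH `x`-COEFFICIENTS DIVISIBLE BY `y^o` IS ZERO. -/
theorem eq_zero_of_eval₂_eq_X_pow_mul {o : ℕ} (P : Polynomial (MvPowerSeries (Fin 1) K)) (hP : P.natDegree < o)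
    (Q : MvPowerSeries (Fin 2) K) (h : P.eval₂ (rename (Fin.succAboveEmb (Fin.last 1))).toRingHom (X (Fin.last 1)) = X (Fin.last 1) ^ o * Q) :
    P = 0 := by
  classical
  refine Polynomial.ext fun n => ?_
  rw [Polynomial.coeff_zero]
  by_cases hn : n < o
  · refine MvPowerSeries.ext fun β => ?_
    have hc := congrArg (coeff (Finsupp.embDomain (Fin.succAboveEmb (Fin.last 1)) β + Finsupp.single (Fin.last 1) n)) h
    rw [coeff_eval₂_rename, X_pow_eq, coeff_monomial_mul, if_neg] at hc
    · rw [map_zero]; exact hc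
    · intro hle
      have h1 := hle (Fin.last 1)
      rw [Finsupp.single_eq_same, Finsupp.add_apply, Finsupp.single_eq_same, Finsupp.embDomain_notin_range, zero_add] at h1
      · omega
      · rintro ⟨i, hi⟩
        exact Fin.succAbove_ne _ i hi
  · exact Polynomial.coeff_eq_zero_of_natDegree_lt (by omega)

/-- THE SHIFT `y ↦ y + b(x)` acts on `y`-polynomials with `x`-coefficients by `Polynomial.taylor b`. -/
theorem subst_shift_eval₂ (P : Polynomial (MvPowerSeries (Fin 1) K)) (b : MvPowerSeries (Fin 1) K) (hb : constantCoeff b = 0) :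
    subst (![X 0, X 1 + rename (Fin.succAboveEmb (Fin.last 1)) b] : Fin 2 → MvPowerSeries (Fin 2) K)
        (P.eval₂ (rename (Fin.succAboveEmb (Fin.last 1))).toRingHom (X (Fin.last 1))) =
      (Polynomial.taylor b P).eval₂ (rename (Fin.succAboveEmb (Fin.last 1))).toRingHom (X (Fin.last 1)) := by
  have hb' : constantCoeff (rename (Fin.succAboveEmb (Fin.last 1)) b : MvPowerSeries (Fin 2) K) = 0 := by
    rw [constantCoeff_rename, hb]
  have hs : HasSubst (![X 0, X 1 + rename (Fin.succAboveEmb (Fin.last 1)) b] : Fin 2 → MvPowerSeries (Fin 2) K) :=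
    hasSubst_of_constantCoeff_zero fun i => by fin_cases i <;> simp [constantCoeff_X, hb]
  rw [← coe_substAlgHom hs, ← AlgHom.coe_toRingHom, Polynomial.hom_eval₂, Polynomial.taylor_apply, Polynomial.eval₂_comp,
    Polynomial.eval₂_add, Polynomial.eval₂_X, Polynomial.eval₂_C]
  congr 1
  · ext r : 1
    simp only [RingHom.coe_comp, Function.comp_apply, AlgHom.coe_toRingHom, coe_substAlgHom]
    exact subst_shift_rename _ hb' r
  · rw [AlgHom.coe_toRingHom, coe_substAlgHom, subst_X hs (Fin.last 1)]
    rfl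

/-- **THE DISTINGUISHED-POLYNOMIAL COMPARISON.**  If `v · (y^o + Σ_{j<o} r_j(x) y^j) = W · (y + a(x))^o` in `K⟦x, y⟧` with `v(0) ≠ 0`
and `a(0) = 0`, then `r_j = C(o, j) · a^{o−j}` for every `j < o` — the monic polynomial IS `(y + a)^o`.  (After the legal change
`y ↦ y − a(x)` the difference `M − (T + a)^o`, of degree `< o`, is `y^o`-divisible as a germ, hence zero; `Polynomial.taylor` is invertible.)
[OURS · L1 W4.3] -/
theorem distinguished_eq_branch_pow {o : ℕ} (v W : MvPowerSeries (Fin 2) K) (hv : constantCoeff v ≠ 0)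
    (r : Fin o → MvPowerSeries (Fin 1) K) (a : MvPowerSeries (Fin 1) K) (ha : constantCoeff a = 0)
    (heq : v * (X (Fin.last 1) ^ o + ∑ j : Fin o, rename (Fin.succAboveEmb (Fin.last 1)) (r j) * X (Fin.last 1) ^ (j : ℕ)) =
      W * (X (Fin.last 1) + rename (Fin.succAboveEmb (Fin.last 1)) a) ^ o) :
    ∀ j : Fin o, r j = (o.choose j : MvPowerSeries (Fin 1) K) * a ^ (o - j) := by
  classical
  intro j₀
  have ho : 0 < o := Fin.pos j₀
  set ι : MvPowerSeries (Fin 1) K →+* MvPowerSeries (Fin 2) K := (rename (Fin.succAboveEmb (Fin.last 1))).toRingHom with hι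
  have hιa : ∀ q, ι q = rename (Fin.succAboveEmb (Fin.last 1)) q := fun q => rfl
  -- the monic polynomial `M = T^o + Σ r_j T^j` and the branch power `B = (T + C a)^o`
  set M : Polynomial (MvPowerSeries (Fin 1) K) := Polynomial.X ^ o + ∑ j : Fin o, Polynomial.C (r j) * Polynomial.X ^ (j : ℕ) with hM
  set B : Polynomial (MvPowerSeries (Fin 1) K) := (Polynomial.X + Polynomial.C a) ^ o with hB
  have hMev : M.eval₂ ι (X (Fin.last 1)) =
      X (Fin.last 1) ^ o + ∑ j : Fin o, rename (Fin.succAboveEmb (Fin.last 1)) (r j) * X (Fin.last 1) ^ (j : ℕ) := by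
    rw [hM, Polynomial.eval₂_add, Polynomial.eval₂_X_pow, Polynomial.eval₂_finsetSum]
    simp only [Polynomial.eval₂_mul, Polynomial.eval₂_C, Polynomial.eval₂_X_pow, hιa]
  have hBev : B.eval₂ ι (X (Fin.last 1)) = (X (Fin.last 1) + rename (Fin.succAboveEmb (Fin.last 1)) a) ^ o := by
    rw [hB, Polynomial.eval₂_pow, Polynomial.eval₂_add, Polynomial.eval₂_X, Polynomial.eval₂_C, hιa]
  -- coefficients of `M` and `B`
  have hMcoeff : ∀ n, M.coeff n = (if n = o then 1 else 0) + ∑ j : Fin o, if n = (j : ℕ) then r j else 0 := by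
    intro n
    rw [hM, Polynomial.coeff_add, Polynomial.coeff_X_pow, Polynomial.finsetSum_coeff]
    congr 1
    exact Finset.sum_congr rfl fun j _ => by rw [Polynomial.coeff_C_mul, Polynomial.coeff_X_pow, mul_ite, mul_one, mul_zero]
  have hBcoeff : ∀ n, B.coeff n = a ^ (o - n) * (o.choose n : MvPowerSeries (Fin 1) K) := fun n => by
    rw [hB, Polynomial.coeff_X_add_C_pow]
  -- the difference `D = M − B` has degree `< o`
  set D := M - B with hD
  have hDcoeff : ∀ n, o ≤ n → D.coeff n = 0 := by
    intro n hn
    rw [hD, Polynomial.coeff_sub, hMcoeff, hBcoeff, Finset.sum_eq_zero (fun j _ => if_neg (by have := j.2; omega)), add_zero]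
    rcases hn.eq_or_lt with rfl | hlt
    · rw [if_pos rfl, Nat.sub_self, pow_zero, Nat.choose_self, Nat.cast_one, mul_one, sub_self]
    · rw [if_neg (by omega), Nat.choose_eq_zero_of_lt hlt, Nat.cast_zero, mul_zero, sub_self]
  have hDnat : D.natDegree < o := by
    rcases eq_or_ne D 0 with h0 | h0
    · rw [h0, Polynomial.natDegree_zero]; exact ho
    · exact (Polynomial.natDegree_lt_iff_degree_lt h0).mpr ((Polynomial.degree_lt_iff_coeff_zero D o).mpr hDcoeff)
  -- `D` evaluates to `(v⁻¹ W − 1) · (y + a)^o`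
  have hvU : IsUnit v := by rwa [isUnit_iff_constantCoeff, isUnit_iff_ne_zero]
  obtain ⟨vu, hvu⟩ := hvU
  have hDev : D.eval₂ ι (X (Fin.last 1)) =
      ((↑vu⁻¹ : MvPowerSeries (Fin 2) K) * W - 1) * (X (Fin.last 1) + rename (Fin.succAboveEmb (Fin.last 1)) a) ^ o := by
    rw [hD, Polynomial.eval₂_sub, hMev, hBev]
    have h1 : X (Fin.last 1) ^ o + ∑ j : Fin o, rename (Fin.succAboveEmb (Fin.last 1)) (r j) * X (Fin.last 1) ^ (j : ℕ) =
        (↑vu⁻¹ : MvPowerSeries (Fin 2) K) * (W * (X (Fin.last 1) + rename (Fin.succAboveEmb (Fin.last 1)) a) ^ o) := by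
      rw [← heq, ← mul_assoc, ← hvu, Units.inv_mul, one_mul]
    rw [h1]
    ring
  -- shift by `y ↦ y − a(x)`: the shifted `D` is `y^o`-divisible
  have hna : constantCoeff (-a) = 0 := by rw [map_neg, ha, neg_zero]
  have hna' : constantCoeff (rename (Fin.succAboveEmb (Fin.last 1)) (-a) : MvPowerSeries (Fin 2) K) = 0 := by
    rw [constantCoeff_rename, hna]
  have hs : HasSubst (![X 0, X 1 + rename (Fin.succAboveEmb (Fin.last 1)) (-a)] : Fin 2 → MvPowerSeries (Fin 2) K) :=
    hasSubst_of_constantCoeff_zero fun i => by fin_cases i <;> simp [constantCoeff_X, ha]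
  have hshift := subst_shift_eval₂ D (-a) hna
  rw [hDev, ← coe_substAlgHom hs, map_mul, map_pow, map_add, coe_substAlgHom, subst_shift_rename _ hna', subst_X hs (Fin.last 1)] at hshift
  have hy : ((![X 0, X 1 + rename (Fin.succAboveEmb (Fin.last 1)) (-a)] : Fin 2 → MvPowerSeries (Fin 2) K) (Fin.last 1) +
      rename (Fin.succAboveEmb (Fin.last 1)) a) = X (Fin.last 1) := by
    rw [show ((![X 0, X 1 + rename (Fin.succAboveEmb (Fin.last 1)) (-a)] : Fin 2 → MvPowerSeries (Fin 2) K) (Fin.last 1)) =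
      X 1 + rename (Fin.succAboveEmb (Fin.last 1)) (-a) from rfl, map_neg]
    show X 1 + -rename (Fin.succAboveEmb (Fin.last 1)) a + rename (Fin.succAboveEmb (Fin.last 1)) a = X 1
    abel
  rw [hy] at hshift
  -- so the shifted polynomial vanishes, and so does `D`
  have hT0 : Polynomial.taylor (-a) D = 0 :=
    eq_zero_of_eval₂_eq_X_pow_mul (o := o) _ (by rw [Polynomial.natDegree_taylor]; exact hDnat) _
      (by rw [← hshift]; ring)
  have hD0 : D = 0 := by
    have h := congrArg (Polynomial.taylor a) hT0
    rwa [Polynomial.taylor_taylor, add_neg_cancel, Polynomial.taylor_zero, map_zero] at h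
  -- read off the coefficient of `T^{j₀}`
  have hj : D.coeff j₀ = 0 := by rw [hD0, Polynomial.coeff_zero]
  rw [hD, Polynomial.coeff_sub, hMcoeff, hBcoeff, if_neg (by have := j₀.2; omega), zero_add, Finset.sum_eq_single j₀,
    if_pos rfl, sub_eq_zero] at hj
  · rw [hj, mul_comm]
  · intro j _ hne; exact if_neg (fun h => hne (Fin.ext h).symm)
  · intro h; exact absurd (Finset.mem_univ _) h

end TOT2Curve

end Summit.ResolutionOfSingularities.ResolutionOfSingularities.Theorems

end
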